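import Summits.BirchSwinnertonDyer.Rank1Residual.GaloisImage.KolyvaginSystemOfEulerSystemPropagated
import Summits.BirchSwinnertonDyer.Rank1Residual.GaloisImage.TorsionPadicIntCoefficients
import Summits.BirchSwinnertonDyer.Rank1Residual.GaloisImage.TorsionPadicIntCoefficientsLocal
import Literature.NumberTheory.EllipticCurves.TateModuleProjSurjectiveProofs
import HarnessLib

/-!
# THEOREM D for `𝓕_can` in the coefficient reading `T′ = E[p^{k+1}]_{ℤ_p}` (GZ-2
# `TorsionCoeff.torsionRepPadicInt`): the consumer-facing socket with every coefficient binder of D4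
# discharged
# (cell `b2b-bsdres`, n1011 p11 GEN 10; row T-DER, THEOREM D file D6)

HONEST FRAMING (cell `b2b-bsdres`, run/shared/lean/b2b/bsd-rank1-residual/, verbatim in every
file): the goal of the cell is to DELETE the COMBINATION-SHAPED residual classes of the
Birch–Swinnerton-Dyer formula for ALL analytic-rank `≤ 1` elliptic curves over `ℚ` — "full BSD
formula for every rank `≤ 1` curve in class `C`" assembled STRICTLY from published theorems — so
that the rank-`≤ 1` remainder becomes exactly the CONSTRUCTION-SHAPED classes, which are TYPED
(missing-input `Prop`s), NOT attempted. This is not "finishing BSD". Team n1011: research route on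
the CONSTRUCTION-SHAPED class X4 / §I N11 (route-1 PORT, (P-DER), clause C1/C0); TOOL theorem.
HONEST LIMITS: NO Euler system is asserted to exist (hypothesis `hc`; the PORT binds Kato's
`ZetaBody … |>.1` by the §48.4 socket); clause C1 is met with `κ′ = κ`; the value clauses C2/C3 are
NOT here; the row-class certificates `hbad` (`E(ℚ_w)[p] = 0` at the bad `w ≠ p`) and `htop`
(`𝓕_can,p = ⊤`; F11/F12 at `p = 3`, `t = 0`) are DISPLAYED.  No definition, no named fact, no
`sorry`; the `ℤ_p`-module structure on `E[p^{k+1}]` is GZ-2's reducible `def`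
`TorsionCoeff.torsionBy.padicIntModule`, activated by a `letI` INSIDE the statement (no `attribute`).

## What

**`exists_isKolyvaginSystem_propagatedSelmerStructure_torsionCoeff`** = D4
`exists_isKolyvaginSystem_propagatedSelmerStructure` with the generic coefficient system
`(T′, red, e, einv)` INSTANTIATED: `T′ = E[p^{k+1}]_{ℤ_p}` (`TorsionCoeff.torsionRepPadicInt W p (k+1)`),
`red = TorsionCoeff.tateModuleRed` (`a ↦ a_{k+1}`, onto by `proj_surjective_of_isAlgClosed_holds`,
killed by `p^{k+1}` by `TorsionCoeff.pow_smul_eq_zero`), `e`/`einv` the identity of `E[p^{k+1}]` read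
along `geomTorsion W (p^{k+1}) = geomTorsion W (p^k·p)` (GZ-4 `TorsionCoeff.geomTorsion_pow_succ_eq`).
Remaining binders — exactly the PORT's: `hp2`, the Euler system `hc`, `Irr(E[p])`, the datum
(`hT`, `hD`, `hPr`, `hKol`), `hbad`, `htop`.  Output: `σ`, transports `Φ_r` computed on cocycles by
the identity, `comm`, and ONE family `κ` with `D.IsKolyvaginSystem (propagatedSelmerStructure W p k) κ`
and `res_{U_r} (κ r) = D_r (Φ_r (red_{k+1,*} c_{0,r}))` at every level.
References: B. Mazur, K. Rubin, Mem. AMS 799 (2004), Thm. 3.2.4, App. A; K. Rubin, *Euler Systems*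
(2000), §4.4; J. Silverman, *AEC*, III.§7.
-/

noncomputable section

open CategoryTheory Function Finset Polynomial Field IsDedekindDomain
open scoped NumberField Classical
open Literature.NumberTheory.GaloisRepresentations Literature.NumberTheory.EllipticCurves
open Literature.NumberTheory.GaloisRepresentations.DiscreteGaloisModule
open Literature.NumberTheory.GaloisCohomology
open Summit.BirchSwinnertonDyer.Rank1Residual.GaloisImage.CoeffTransport
open Summit.BirchSwinnertonDyer.Rank1Residual.GaloisImage.CyclotomicLevel
open Summit.BirchSwinnertonDyer.Rank1Residual.GaloisImage.TorsionCoeff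
open Rat.HeightOneSpectrum

universe u

namespace Summit.BirchSwinnertonDyer.Rank1Residual.GaloisImage.Derivative.Rat

variable (W : WeierstrassCurve ℚ) [W.IsElliptic] [W.IsGloballyMinimal] (p : ℕ) [Fact p.Prime]
variable [Module.Free ℤ_[p] (W.tateModule p)] [Module.Finite ℤ_[p] (W.tateModule p)]
  [ContinuousSMul ℤ_[p] (W.tateModule p)]

/-- Local notation: `T∞ = T_p E` as a continuous `G_ℚ`-representation. -/
local notation3 "T∞" => WeierstrassCurve.tateGaloisRep W p (W.continuous_galoisRepTate_holds p)

variable (S : Set (HeightOneSpectrum (𝓞 ℚ)))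

/-- Local notation: `𝓛` = the cyclotomic Euler-system levels `ℚ(μ_{p^{n+1}}, μ_r)`, `r ∩ S = ∅`. -/
local notation3 "𝓛" => cyclotomicLevelsRat p S

/-- Local notation: `𝐃ℤ⟦X, U, τ⟧ ℓ = ∑_{j < ℓ−1} j·(τ_ℓ)_*^j` on `H¹(U, X)` (`ℤ`-linear). -/
local notation3 (prettyPrint := false) "𝐃ℤ⟦" X ", " U ", " τ "⟧" =>
  fun ℓ : HeightOneSpectrum (𝓞 ℚ) =>
  ∑ j ∈ Finset.range (((primesEquiv ℓ : Nat.Primes) : ℕ) - 1),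
    (j : Module.End ℤ (continuousCohomology 1 (subgroupRep X U))) *
      (conjMap X U ((τ : HeightOneSpectrum (𝓞 ℚ) → absoluteGaloisGroup ℚ) ℓ) 1).hom.toLinearMap ^ j

/-- **THEOREM D for `𝓕_can` on `E[p^k·p]`, coefficients `E[p^{k+1}]_{ℤ_p}`** — see the module
docstring; the only displayed binders are the PORT's.
[cite: MazurRubin2004, Thm. 3.2.4 and App. A] [cite: Rubin2000, Def. 4.4.10 and Thm. 4.5.4]
[cite: Sakamoto2024, Def. 4.1 (p. 926)] -/
theorem exists_isKolyvaginSystem_propagatedSelmerStructure_torsionCoeff (hp2 : p ≠ 2)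
    {c : ∀ (i : ℕ) (r : (𝓛).Ideals), H1 T∞ ((𝓛).level i r.1)}
    (hc : IsEulerSystem 𝓛 T∞ p c) (k : ℕ)
    (hirr : W.HasIrreducibleModPGaloisRep p)
    (D : KolyvaginDatum (W.torsionGaloisModule ((p : ℤ) ^ k * (p : ℤ))))
    (hT : D.transverse = cyclotomicTransverse (W.torsionGaloisModule ((p : ℤ) ^ k * (p : ℤ))))
    {η : (ℓ : HeightOneSpectrum (𝓞 ℚ)) → (ZMod (Ideal.absNorm ℓ.asIdeal))ˣ}
    (hD : D.HasCanonicalComparison (p ^ (k + 1)) η)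
    (hPr : D.primes ⊆ (𝓛).primes)
    (hKol : ∀ ℓ ∈ D.primes, Kato.IsKolyvaginPrime W p (k + 1) ((primesEquiv ℓ : Nat.Primes) : ℕ))
    (hbad : ∀ w : HeightOneSpectrum (𝓞 ℚ), ¬ W.HasGoodReductionAt w →
      ((primesEquiv w : Nat.Primes) : ℕ) ≠ p →
        ∀ P : (W.baseChange (w.adicCompletion ℚ)).toAffine.Point, p • P = 0 → P = 0)
    (htop : ∀ w : HeightOneSpectrum (𝓞 ℚ), ((primesEquiv w : Nat.Primes) : ℕ) = p →
      propagatedSelmerStructure W p k (Sum.inr w) = ⊤) :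
    letI := TorsionCoeff.torsionBy.padicIntModule p (k + 1) (WeierstrassCurve.geomPoints W)
    ∃ (σ : HeightOneSpectrum (𝓞 ℚ) → absoluteGaloisGroup ℚ)
      (Φ : ∀ r : Finset (HeightOneSpectrum (𝓞 ℚ)),
        continuousCohomology 1 (subgroupRep (torsionRepPadicInt W p (k + 1)).toTopRep ((𝓛).level ⊥ r)) →+
          continuousCohomology 1 (subgroupRep
            (W.torsionGaloisModule ((p : ℤ) ^ k * (p : ℤ))).toTopRep ((𝓛).level ⊥ r)))
      (comm : ∀ r : Finset (HeightOneSpectrum (𝓞 ℚ)),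
        ((r : Finset _) : Set (HeightOneSpectrum (𝓞 ℚ))).Pairwise fun a b =>
          Commute (𝐃ℤ⟦(W.torsionGaloisModule ((p : ℤ) ^ k * (p : ℤ))).toTopRep, ((𝓛).level ⊥ r), σ⟧ a)
            (𝐃ℤ⟦(W.torsionGaloisModule ((p : ℤ) ^ k * (p : ℤ))).toTopRep, ((𝓛).level ⊥ r), σ⟧ b))
      (κ : Finset (HeightOneSpectrum (𝓞 ℚ)) →
        galoisCohomology (W.torsionGaloisModule ((p : ℤ) ^ k * (p : ℤ))) 1),
      (∀ ℓ, σ ℓ ∈ (adicCompletionPrime ℚ ℓ).inertia (absoluteGaloisGroup ℚ)) ∧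
      (∀ ℓ, modNCyclotomicCharacter ℚ (Ideal.absNorm ℓ.asIdeal) (σ ℓ) = η ℓ) ∧
      (∀ r, ∀ (φ : contOneCocycles (subgroupRep (torsionRepPadicInt W p (k + 1)).toTopRep ((𝓛).level ⊥ r)))
        (ψ : contOneCocycles (subgroupRep
          (W.torsionGaloisModule ((p : ℤ) ^ k * (p : ℤ))).toTopRep ((𝓛).level ⊥ r))),
        (∀ g, ψ.1 g = AddSubgroup.inclusion (geomTorsion_pow_succ_eq W p k).le (φ.1 g)) →
          Φ r (oneCocycleClass _ φ) = oneCocycleClass _ ψ) ∧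
      D.IsKolyvaginSystem (propagatedSelmerStructure W p k) κ ∧
      (∀ r : Finset (HeightOneSpectrum (𝓞 ℚ)), ¬ (↑r : Set _) ⊆ D.primes → κ r = 0) ∧
      ∀ (r : Finset (HeightOneSpectrum (𝓞 ℚ))) (hr : (↑r : Set _) ⊆ D.primes),
        resSubgroup (W.torsionGaloisModule ((p : ℤ) ^ k * (p : ℤ))).toTopRep ((𝓛).level ⊥ r) 1 (κ r) =
          (r.noncommProd 𝐃ℤ⟦(W.torsionGaloisModule ((p : ℤ) ^ k * (p : ℤ))).toTopRep,
              ((𝓛).level ⊥ r), σ⟧ (comm r))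
            (Φ r (ContinuousCohomology.map (ContinuousMonoidHom.id _)
              (X := subgroupRep T∞.toTopRep ((𝓛).level ⊥ r))
              (Y := subgroupRep (torsionRepPadicInt W p (k + 1)).toTopRep ((𝓛).level ⊥ r))
              ((TopRep.resFunctor ((𝓛).level ⊥ r).subtype).map
                (tateModuleRed W p (W.continuous_galoisRepTate_holds p) (k + 1))) 1
              (c ⊥ ⟨r, fun _ hq => hPr (hr (Finset.mem_coe.2 hq))⟩))) := by
  letI := TorsionCoeff.torsionBy.padicIntModule p (k + 1) (WeierstrassCurve.geomPoints W)
  have hle := (geomTorsion_pow_succ_eq W p k).le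
  have hge := (geomTorsion_pow_succ_eq W p k).ge
  -- `red = a ↦ a_{k+1}` is onto
  have hred : Function.Surjective
      (tateModuleRed W p (W.continuous_galoisRepTate_holds p) (k + 1)).hom := by
    intro y
    obtain ⟨a, ha⟩ := W.proj_surjective_of_isAlgClosed_holds p (k + 1) y.2
    exact ⟨a, Subtype.ext ha⟩
  exact exists_isKolyvaginSystem_propagatedSelmerStructure W p S hp2 hc
    (tateModuleRed W p (W.continuous_galoisRepTate_holds p) (k + 1)) hred
    (fun m => pow_smul_eq_zero p (k + 1) _ m)
    (AddSubgroup.inclusion hle : _ →+ _) continuous_of_discreteTopology (fun _ _ => rfl)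
    (AddSubgroup.inclusion hge : _ →+ _) continuous_of_discreteTopology
    (fun x => Subtype.ext rfl) (fun y => Subtype.ext rfl) hirr D hT hD hPr hKol hbad htop

end Summit.BirchSwinnertonDyer.Rank1Residual.GaloisImage.Derivative.Rat

end
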